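import Summits.BirchSwinnertonDyer.BirchSwinnertonDyer.Theorems.BiquadraticEisensteinDescentHeegnerTwistCouplingInSupplyQuarticTwistDescentDual
import HarnessLib

set_option linter.dupNamespace false -- `Summit.BirchSwinnertonDyer.BirchSwinnertonDyer.Theorems.…` (summit = sub)
set_option autoImplicit false

/-!
# Crux `HeegnerTwistCouplingInSupply` (stmt-BirchSwinnertonDyer-21381) — the QUARTIC `j = 1728` corner `W_p⁻ : y² = x³ − p·x`,
# TRIPLE TWIST, I: `S(0, −s²q²ℓ²p) = {1, −p}` for primes `s ≡ 1`, `q ≡ 3`, `ℓ ≡ 5 (mod 8)` with `(s/p) = (q/p) = (ℓ/p) = −1`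

Route `BiquadraticEisensteinDescent` (cell `pub/bsd-wall`, width seat `bsd-wall-cm-bed-w4` g14; `--supports` 21381, helper). The H⁻ corner
`W_p⁻ : y² = x³ − p·x` (`p ≡ 7 (mod 8)`, CM by `ℤ[i]`, `p` inert and bad, root number `−1`) was treated by bed-w4 g13 with TWO-prime twists
`d = −rq` (`…QuarticPartnerDescent`), whose sharpness is governed by a FOURTH-POWER symbol (`p ∉ 𝔽_r^{×4}`); numerically no two-prime twist of
`W_p⁻` is Legendre-sharp. This file starts the THREE-prime twist `d = −sqℓ` with

  `s ≡ 1 (mod 8)`, `(s/p) = −1`;  `q ≡ 3 (mod 8)`, `(q/p) = −1`;  `ℓ ≡ 5 (mod 8)`, `(ℓ/p) = −1`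

(`d ≡ 1 (mod 8)`, `(d/p) = +1`: `K′ = ℚ(√d)` is Heegner for `N(W_p⁻)`), for which the descent via `2`-isogeny of the twist
`W_p⁻^{(d)} : y² = x³ − s²q²ℓ²p·x` is SHARP for ALL mutual symbols `(s/q), (s/ℓ), (q/ℓ)` — a LEGENDRE-ONLY law (numerics: 349/349 cases,
`p < 200`, `|d| < 2·10⁴`, crux memo QUARTIC-TRIPLE-w4g14.md). This side: ★ `mem_selmer_neg_iff_triple`, **`S(0, −s²q²ℓ²p) = {1, −p}`**.

Kills: every class divisible by `s` or by `ℓ` dies at that prime (§1 `not_mem_selmer_of_prime_dvd`: both coefficients once divisible by `t`,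
reduced form `c₀x⁴ + c₀′y⁴` anisotropic because `−c₀c₀′ = −b/t² = p·□` and `(p/s) = (p/ℓ) = −1` — the hypothesis is on the PRODUCT
`c₀c₀′`, so no case split over the divisor is needed); of the remaining `±1, ±q, ±p, ±pq`: `−1, p, q, −pq` die at `p` (non-residues
`−1`, `−□`, `q`, `q·□`), `−q`, `pq` die at `2` (`(5, 5) (mod 8)`: no solutions modulo `8`). Tools: `…QuarticTwistLocal`.
HONEST FRAMING: a typed sub-corner on one CM family (measure zero in «all CM `W`»); the crux (residual C⁺) is untouched; BSD is not proved
by any of this. THEOREMS ONLY (no `def`, no named fact, no `sorry`). Supports stmt-BirchSwinnertonDyer-21381.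
-/

noncomputable section

open scoped Classical

namespace Summit.BirchSwinnertonDyer.BirchSwinnertonDyer.Theorems.BiquadraticEisensteinDescentHeegnerTwistCouplingInSupplyQuarticMinusTripleDescent

open Literature.NumberTheory.EllipticCurves Literature.NumberTheory.EllipticCurves.XCubeAddPX
  Summit.BirchSwinnertonDyer.BirchSwinnertonDyer.Theorems.BiquadraticEisensteinDescentHeegnerTwistCouplingInSupplyQuarticTwistLocal
  Summit.BirchSwinnertonDyer.BirchSwinnertonDyer.Theorems.BiquadraticEisensteinDescentHeegnerTwistCouplingInSupplyQuarticTwistDescent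

/-! ## §1 A generic kill: `t ∣ d`, `b = t²·b₀`, `−b₀` a non-residue mod `t` -/

section Generic

variable {t : ℕ} [ht : Fact t.Prime]

/-- **Anisotropy from a non-square product.** In `𝔽_t`: if `c₀ ≠ 0` and `−c₀c₀′` is not a square, the form `c₀x⁴ + c₀′y⁴` has only the
trivial zero (`y ≠ 0` would give `−c₀c₀′ = (c₀x²/y²)²`). [folklore] -/
theorem anisotropic_of_not_isSquare {c₀ c₀' : ℤ} (hc₀ : ((c₀ : ℤ) : ZMod t) ≠ 0)
    (hns : ¬ IsSquare (((-(c₀ * c₀') : ℤ)) : ZMod t)) :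
    ∀ x y : ZMod t, (c₀ : ZMod t) * x ^ 4 + (c₀' : ZMod t) * y ^ 4 = 0 → x = 0 ∧ y = 0 := by
  intro x y h
  by_cases hy : y = 0
  · subst hy
    have h' : (c₀ : ZMod t) * x ^ 4 = 0 := by simpa using h
    rcases mul_eq_zero.mp h' with h0 | h0
    · exact absurd h0 hc₀
    · exact ⟨(pow_eq_zero_iff four_ne_zero).mp h0, rfl⟩
  · exfalso
    apply hns
    refine ⟨(c₀ : ZMod t) * x ^ 2 / y ^ 2, ?_⟩
    have hy2 : (y : ZMod t) ^ 2 ≠ 0 := pow_ne_zero 2 hy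
    push_cast
    field_simp
    linear_combination -h

/-- ★ **Generic kill.** For a prime `t`, `b = t²·b₀` (`b ≠ 0`) with `−b₀` a NON-residue mod `t`: no squarefree `d` divisible by `t` lies in
`S(0, b)`. Writing `d = t·d₁` (`t ∤ d₁`, `d₁ ∣ b₀`, `b/d = t·(b₀/d₁)`), both coefficients of `w² = d u⁴ + (b/d) z⁴` are once divisible by
`t` and the reduced form is anisotropic mod `t` since `−d₁·(b₀/d₁) = −b₀`. [cite: SilvermanAEC2009, Prop. X.4.9 and proof of Prop. X.6.2(b)] -/
theorem not_mem_selmer_of_prime_dvd {b b₀ d : ℤ} (hb : b = (t : ℤ) ^ 2 * b₀) (hns : ¬ IsSquare (((-b₀ : ℤ)) : ZMod t))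
    (htd : (t : ℤ) ∣ d) : d ∉ twoIsogenySelmerGroup 0 b := by
  intro hd
  have hsq := squarefree_of_mem_twoIsogenySelmerGroup hd
  have hdb : d ∣ b := dvd_of_mem_twoIsogenySelmerGroup hd
  obtain ⟨d₁, rfl⟩ := htd
  have htI : Prime (t : ℤ) := Nat.prime_iff_prime_int.mp ht.out
  have ht0 : (t : ℤ) ≠ 0 := htI.ne_zero
  have htd₁ : ¬ (t : ℤ) ∣ d₁ := by
    rintro ⟨e, rfl⟩
    exact htI.not_unit (hsq (t : ℤ) ⟨e, by ring⟩)
  have hd₁ : d₁ ∣ b₀ := by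
    have h1 : d₁ ∣ (t : ℤ) * b₀ := by
      have h2 : (t : ℤ) * d₁ ∣ (t : ℤ) * ((t : ℤ) * b₀) := by rw [hb] at hdb; simpa [sq, mul_assoc] using hdb
      exact (mul_dvd_mul_iff_left ht0).mp h2
    exact ((htI.coprime_iff_not_dvd.mpr htd₁).symm).dvd_of_dvd_mul_left h1
  obtain ⟨e, he⟩ := hd₁
  have key := isLocallySoluble_of_mem hsq.ne_zero (show ((t : ℤ) * d₁) * ((t : ℤ) * e) = b by rw [hb, he]; ring) hd
  have hd₁0 : ((d₁ : ℤ) : ZMod t) ≠ 0 := by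
    rw [Ne, ZMod.intCast_zmod_eq_zero_iff_dvd]; exact htd₁
  have hns' : ¬ IsSquare (((-(d₁ * e) : ℤ)) : ZMod t) := by rw [← he]; exact hns
  haveI : Fact (Nat.Prime 2) := ⟨Nat.prime_two⟩
  exact not_isSoluble_padic_of_dvd_of_dvd (ℓ := t) (c := (t : ℤ) * d₁) (c' := (t : ℤ) * e) (c₀ := d₁) (c₀' := e) rfl rfl
    (anisotropic_of_not_isSquare hd₁0 hns') (key.2 t)

end Generic

/-! ## §2 Residues: `p ≡ 7 (mod 8)`, `(q/p) = −1`; `(p/s) = (p/ℓ) = −1` -/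

section Residues

variable {p q s l : ℕ} [hp : Fact p.Prime] [hq : Fact q.Prime] [hs : Fact s.Prime] [hl : Fact l.Prime]

omit hq hs hl in
/-- Casting helper: for naturals `m` with `p ∤ m`, `(m : 𝔽_p) ≠ 0`. [folklore] -/
theorem natCast_ne_zero_of_not_dvd {m : ℕ} (h : ¬ p ∣ m) : ((m : ℤ) : ZMod p) ≠ 0 := by
  intro h0
  exact h (by exact_mod_cast (ZMod.intCast_zmod_eq_zero_iff_dvd m p).mp h0)

omit hq hs hl in
/-- The non-residues of the `p`-kills: `−1`, `−(sqℓ)²`, `q·(sℓ)²` (given `(q/p) = −1`, `p ∤ sqℓ`). [folklore] -/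
theorem nonresidues_mod_p_triple (hp4 : p % 4 = 3) (hnq : ¬ IsSquare ((q : ℤ) : ZMod p)) (hpsql : ¬ p ∣ s * q * l) :
    ¬ IsSquare (((-1 : ℤ)) : ZMod p) ∧ ¬ IsSquare (((-(s ^ 2 * q ^ 2 * l ^ 2) : ℤ)) : ZMod p) ∧
      ¬ IsSquare (((s ^ 2 * q * l ^ 2 : ℤ)) : ZMod p) := by
  have hm1 := not_isSquare_neg_one (p := p) hp4
  have hsql0 : (((s * q * l : ℕ) : ℤ) : ZMod p) ≠ 0 := natCast_ne_zero_of_not_dvd hpsql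
  have hsl0 : (((s * l : ℕ) : ℤ) : ZMod p) ≠ 0 :=
    natCast_ne_zero_of_not_dvd fun h => hpsql (by rw [show s * q * l = s * l * q by ring]; exact h.mul_right q)
  refine ⟨hm1, ?_, ?_⟩
  · have e : (((-(s ^ 2 * q ^ 2 * l ^ 2) : ℤ)) : ZMod p) =
        (((-1 : ℤ)) : ZMod p) * ((((s * q * l : ℕ) : ℤ) : ZMod p) * (((s * q * l : ℕ) : ℤ) : ZMod p)) := by
      push_cast; ring
    rw [e]
    exact not_isSquare_mul_of_isSquare hm1 ⟨_, rfl⟩ (mul_ne_zero hsql0 hsql0)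
  · have e : (((s ^ 2 * q * l ^ 2 : ℤ)) : ZMod p) =
        ((q : ℤ) : ZMod p) * ((((s * l : ℕ) : ℤ) : ZMod p) * (((s * l : ℕ) : ℤ) : ZMod p)) := by
      push_cast; ring
    rw [e]
    exact not_isSquare_mul_of_isSquare hnq ⟨_, rfl⟩ (mul_ne_zero hsl0 hsl0)

omit hp hq hl in
/-- `−b₀ = q²ℓ²p` is a non-residue mod `s` when `(p/s) = −1` and `s ∤ qℓ`. [folklore] -/
theorem not_isSquare_strip_s (hps : ¬ IsSquare ((p : ℤ) : ZMod s)) (hsql : ¬ s ∣ q * l) :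
    ¬ IsSquare (((-(-(q ^ 2 * l ^ 2 * p)) : ℤ)) : ZMod s) := by
  have h0 : (((q * l : ℕ) : ℤ) : ZMod s) ≠ 0 := by
    intro h; exact hsql (by exact_mod_cast (ZMod.intCast_zmod_eq_zero_iff_dvd (q * l) s).mp h)
  have e : (((-(-(q ^ 2 * l ^ 2 * p)) : ℤ)) : ZMod s) =
      ((p : ℤ) : ZMod s) * ((((q * l : ℕ) : ℤ) : ZMod s) * (((q * l : ℕ) : ℤ) : ZMod s)) := by
    push_cast; ring
  rw [e]
  exact not_isSquare_mul_of_isSquare hps ⟨_, rfl⟩ (mul_ne_zero h0 h0)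

omit hp hq hs in
/-- `−b₀ = s²q²p` is a non-residue mod `ℓ` when `(p/ℓ) = −1` and `ℓ ∤ sq`. [folklore] -/
theorem not_isSquare_strip_l (hpl : ¬ IsSquare ((p : ℤ) : ZMod l)) (hlsq : ¬ l ∣ s * q) :
    ¬ IsSquare (((-(-(s ^ 2 * q ^ 2 * p)) : ℤ)) : ZMod l) := by
  have h0 : (((s * q : ℕ) : ℤ) : ZMod l) ≠ 0 := by
    intro h; exact hlsq (by exact_mod_cast (ZMod.intCast_zmod_eq_zero_iff_dvd (s * q) l).mp h)
  have e : (((-(-(s ^ 2 * q ^ 2 * p)) : ℤ)) : ZMod l) =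
      ((p : ℤ) : ZMod l) * ((((s * q : ℕ) : ℤ) : ZMod l) * (((s * q : ℕ) : ℤ) : ZMod l)) := by
    push_cast; ring
  rw [e]
  exact not_isSquare_mul_of_isSquare hpl ⟨_, rfl⟩ (mul_ne_zero h0 h0)

end Residues

/-! ## §3 The side `S(0, −s²q²ℓ²p) = {1, −p}` -/

section SSide

variable {p q s l : ℕ} [hp : Fact p.Prime] [hq : Fact q.Prime] [hs : Fact s.Prime] [hl : Fact l.Prime]

omit hs hl in
/-- The squarefree divisors of `s²q²ℓ²p` prime to `s` and `ℓ`: absolute values among `1, q, p, qp`. [folklore] -/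
theorem natAbs_eq_of_squarefree_dvd_triple {d : ℤ} (hsq : Squarefree d) (hdvd : d ∣ (s ^ 2 * q ^ 2 * l ^ 2 * p : ℤ))
    (hsP : s.Prime) (hlP : l.Prime) (hsd : ¬ (s : ℤ) ∣ d) (hld : ¬ (l : ℤ) ∣ d) :
    d.natAbs = 1 ∨ d.natAbs = q ∨ d.natAbs = p ∨ d.natAbs = q * p := by
  set m := d.natAbs with hm_def
  have hmsq : Squarefree m := Int.squarefree_natAbs.mpr hsq
  have hsm : ¬ s ∣ m := fun h => hsd (Int.natCast_dvd.mpr h)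
  have hlm : ¬ l ∣ m := fun h => hld (Int.natCast_dvd.mpr h)
  have hm1 : m ∣ s ^ 2 * q ^ 2 * l ^ 2 * p := by
    have h1 := Int.natAbs_dvd_natAbs.mpr hdvd
    have h2 : (s ^ 2 * q ^ 2 * l ^ 2 * p : ℤ).natAbs = s ^ 2 * q ^ 2 * l ^ 2 * p := by
      rw [show (s ^ 2 * q ^ 2 * l ^ 2 * p : ℤ) = ((s ^ 2 * q ^ 2 * l ^ 2 * p : ℕ) : ℤ) by push_cast; ring, Int.natAbs_natCast]
    rwa [h2] at h1
  have hm2 : m ∣ (s * (l * (q * p))) ^ 2 := dvd_trans hm1 ⟨p, by ring⟩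
  have hm3 : m ∣ s * (l * (q * p)) := (hmsq.dvd_pow_iff_dvd two_ne_zero).mp hm2
  obtain ⟨a, b, ha, hb, hm⟩ := exists_dvd_and_dvd_of_dvd_mul hm3
  obtain ⟨b₁, b₂, hb₁, hb₂, rfl⟩ := exists_dvd_and_dvd_of_dvd_mul hb
  obtain ⟨c₁, c₂, hc₁, hc₂, rfl⟩ := exists_dvd_and_dvd_of_dvd_mul hb₂
  have ha1 : a = 1 := by
    rcases (Nat.dvd_prime hsP).mp ha with h | h
    · exact h
    · exact absurd ⟨b₁ * (c₁ * c₂), by rw [hm, h]⟩ hsm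
  have hb1 : b₁ = 1 := by
    rcases (Nat.dvd_prime hlP).mp hb₁ with h | h
    · exact h
    · exact absurd ⟨a * (c₁ * c₂), by rw [hm, h]; ring⟩ hlm
  rw [hm, ha1, hb1, one_mul, one_mul]
  rcases (Nat.dvd_prime hq.out).mp hc₁ with h1 | h1 <;> rcases (Nat.dvd_prime hp.out).mp hc₂ with h2 | h2 <;>
    simp [h1, h2]

omit hp hq hs hl in
/-- **The two `2`-adic kills** (`s ≡ 1`, `q ≡ 3`, `ℓ ≡ 5`, `p ≡ 7 (mod 8)`; both charts `≡ (5, 5)·(u⁴, z⁴) (mod 8)`, no solutions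
modulo `8`): the classes `−q` and `pq` of `S(0, −s²q²ℓ²p)`. [cite: SilvermanAEC2009, proof of Prop. X.6.2(b)] -/
theorem two_adic_kills_triple (hs8 : s % 8 = 1) (hq8 : q % 8 = 3) (hl8 : l % 8 = 5) (hp8 : p % 8 = 7) :
    ¬ ((twoIsogenyQuartic 0 (-(q : ℤ)) (s ^ 2 * q * l ^ 2 * p)).map (Int.castRingHom ℚ_[2])).IsSoluble ∧
    ¬ ((twoIsogenyQuartic 0 ((q : ℤ) * p) (-(s ^ 2 * q * l ^ 2 : ℤ))).map (Int.castRingHom ℚ_[2])).IsSoluble := by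
  have hp' : (p : ZMod 8) = 7 := by simpa using natCast_zmod8_of_mod hp8 (by norm_num)
  have hq' : (q : ZMod 8) = 3 := by simpa using natCast_zmod8_of_mod hq8 (by norm_num)
  have hs' : (s : ZMod 8) = 1 := by simpa using natCast_zmod8_of_mod hs8 (by norm_num)
  have hl' : (l : ZMod 8) = 5 := by simpa using natCast_zmod8_of_mod hl8 (by norm_num)
  refine ⟨not_isSoluble_two_of_zmod8 ?_, not_isSoluble_two_of_zmod8 ?_⟩ <;>
  · push_cast
    rw [hp', hq', hs', hl']
    decide

/-- ★ **`S(0, −s²q²ℓ²p) = {1, −p}`** for primes `p ≡ 7 (mod 8)`, `s ≡ 1`, `q ≡ 3`, `ℓ ≡ 5 (mod 8)` with `(q/p) = −1`, `(p/s) = −1`,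
`(p/ℓ) = −1` (i.e. `(s/p) = (ℓ/p) = −1`): descent on the divisors of `b = −s²q²ℓ²p` for the twist `W_p⁻^{(−sqℓ)} : y² = x³ − s²q²ℓ²p·x`.
No fourth-power symbol enters. [cite: SilvermanAEC2009, Prop. X.4.9 and Prop. X.6.1] -/
theorem mem_selmer_neg_iff_triple (hp8 : p % 8 = 7) (hs8 : s % 8 = 1) (hq8 : q % 8 = 3) (hl8 : l % 8 = 5)
    (hnq : ¬ IsSquare ((q : ℤ) : ZMod p)) (hps : ¬ IsSquare ((p : ℤ) : ZMod s)) (hpl : ¬ IsSquare ((p : ℤ) : ZMod l))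
    (d : ℤ) :
    d ∈ twoIsogenySelmerGroup 0 (-(s ^ 2 * q ^ 2 * l ^ 2 * p : ℤ)) ↔ d = 1 ∨ d = -(p : ℤ) := by
  have hP := hp.out
  have hQ := hq.out
  have hS := hs.out
  have hL := hl.out
  have hqp : q ≠ p := by rintro rfl; omega
  have hsp : s ≠ p := by rintro rfl; omega
  have hlp : l ≠ p := by rintro rfl; omega
  have hsq' : s ≠ q := by rintro rfl; omega
  have hsl : s ≠ l := by rintro rfl; omega
  have hql : q ≠ l := by rintro rfl; omega
  have hp0 : (p : ℤ) ≠ 0 := by exact_mod_cast hP.ne_zero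
  have hq0 : (q : ℤ) ≠ 0 := by exact_mod_cast hQ.ne_zero
  have hs0 : (s : ℤ) ≠ 0 := by exact_mod_cast hS.ne_zero
  have hl0 : (l : ℤ) ≠ 0 := by exact_mod_cast hL.ne_zero
  have hb : (-(s ^ 2 * q ^ 2 * l ^ 2 * p : ℤ)) ≠ 0 :=
    neg_ne_zero.mpr (mul_ne_zero (mul_ne_zero (mul_ne_zero (pow_ne_zero 2 hs0) (pow_ne_zero 2 hq0)) (pow_ne_zero 2 hl0)) hp0)
  have hpI : Prime (p : ℤ) := Nat.prime_iff_prime_int.mp hP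
  have ndvd : ∀ {a b : ℕ}, a.Prime → b.Prime → a ≠ b → ¬ a ∣ b := fun ha hb hab h =>
    hab ((Nat.prime_dvd_prime_iff_eq ha hb).mp h)
  -- `p ∤ sqℓ`, `s ∤ qℓ`, `ℓ ∤ sq`
  have hpsql : ¬ p ∣ s * q * l := fun h => by
    rcases (Nat.Prime.dvd_mul hP).mp h with h | h
    · rcases (Nat.Prime.dvd_mul hP).mp h with h | h
      · exact ndvd hP hS (Ne.symm hsp) h
      · exact ndvd hP hQ (Ne.symm hqp) h
    · exact ndvd hP hL (Ne.symm hlp) h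
  have hsql : ¬ s ∣ q * l := fun h => by
    rcases (Nat.Prime.dvd_mul hS).mp h with h | h
    · exact ndvd hS hQ hsq' h
    · exact ndvd hS hL hsl h
  have hlsq : ¬ l ∣ s * q := fun h => by
    rcases (Nat.Prime.dvd_mul hL).mp h with h | h
    · exact ndvd hL hS (Ne.symm hsl) h
    · exact ndvd hL hQ (Ne.symm hql) h
  obtain ⟨hm1, hmsq, hqsq⟩ := nonresidues_mod_p_triple (s := s) (l := l) (by omega) hnq hpsql
  have hnd : ∀ m : ℤ, ¬ (p : ℤ) ∣ m → ¬ (p : ℤ) ^ 2 ∣ (p : ℤ) * m := fun m hm => not_sq_dvd_mul_of_not_dvd hm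
  have hpm : ¬ (p : ℤ) ∣ (s ^ 2 * q ^ 2 * l ^ 2 : ℤ) := by
    intro h
    have h' : (p : ℤ) ∣ ((s * q * l : ℕ) : ℤ) ^ 2 := by
      rw [show (((s * q * l : ℕ) : ℤ)) ^ 2 = (s ^ 2 * q ^ 2 * l ^ 2 : ℤ) by push_cast; ring]; exact h
    exact hpsql (by exact_mod_cast hpI.dvd_of_dvd_pow h')
  have hpm' : ¬ (p : ℤ) ∣ (s ^ 2 * q * l ^ 2 : ℤ) := by
    intro h
    apply hpm
    rw [show (s ^ 2 * q ^ 2 * l ^ 2 : ℤ) = (s ^ 2 * q * l ^ 2) * q by ring]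
    exact h.mul_right _
  haveI : Fact (Nat.Prime 2) := ⟨Nat.prime_two⟩
  obtain ⟨k1, k2⟩ := two_adic_kills_triple (p := p) (q := q) (s := s) (l := l) hs8 hq8 hl8 hp8
  constructor
  · intro hd
    have hsqf := squarefree_of_mem_twoIsogenySelmerGroup hd
    have hd0 : d ≠ 0 := hsqf.ne_zero
    have hdvd : d ∣ (s ^ 2 * q ^ 2 * l ^ 2 * p : ℤ) := dvd_neg.mp (dvd_of_mem_twoIsogenySelmerGroup hd)
    -- classes divisible by `s` or `ℓ` die at `s` / `ℓ`
    have hsd : ¬ (s : ℤ) ∣ d := fun h =>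
      not_mem_selmer_of_prime_dvd (t := s) (b₀ := -(q ^ 2 * l ^ 2 * p : ℤ)) (by ring)
        (not_isSquare_strip_s (p := p) hps hsql) h hd
    have hld : ¬ (l : ℤ) ∣ d := fun h =>
      not_mem_selmer_of_prime_dvd (t := l) (b₀ := -(s ^ 2 * q ^ 2 * p : ℤ)) (by ring)
        (not_isSquare_strip_l (p := p) hpl hlsq) h hd
    have key : ∀ d' : ℤ, d * d' = -(s ^ 2 * q ^ 2 * l ^ 2 * p : ℤ) → (twoIsogenyQuartic 0 d d').IsLocallySoluble :=
      fun d' hdd => isLocallySoluble_of_mem hd0 hdd hd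
    rcases natAbs_eq_of_squarefree_dvd_triple (p := p) (q := q) hsqf hdvd hS hL hsd hld with h | h | h | h <;>
      rcases Int.natAbs_eq d with hd' | hd' <;> rw [h] at hd' <;> push_cast at hd' <;> subst hd'
    · exact Or.inl rfl
    · -- d = -1 : dies at p
      refine absurd ((key (s ^ 2 * q ^ 2 * l ^ 2 * p) (by ring)).2 p) ?_
      exact not_isSoluble_padic_of_dvd_right (c := -1) (c' := s ^ 2 * q ^ 2 * l ^ 2 * p) ⟨s ^ 2 * q ^ 2 * l ^ 2, by ring⟩
        (by rw [show (s ^ 2 * q ^ 2 * l ^ 2 * p : ℤ) = p * (s ^ 2 * q ^ 2 * l ^ 2) by ring]; exact hnd _ hpm) hm1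
    · -- d = q : dies at p
      refine absurd ((key (-(s ^ 2 * q * l ^ 2 * p)) (by ring)).2 p) ?_
      exact not_isSoluble_padic_of_dvd_right (c := (q : ℤ)) (c' := -(s ^ 2 * q * l ^ 2 * p)) ⟨-(s ^ 2 * q * l ^ 2), by ring⟩
        (by rw [show (-(s ^ 2 * q * l ^ 2 * p) : ℤ) = p * (-(s ^ 2 * q * l ^ 2)) by ring]; exact hnd _ (by rwa [dvd_neg])) hnq
    · -- d = -q : dies at 2
      exact absurd ((key (s ^ 2 * q * l ^ 2 * p) (by ring)).2 2) k1
    · -- d = p : dies at p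
      refine absurd ((key (-(s ^ 2 * q ^ 2 * l ^ 2)) (by ring)).2 p) ?_
      exact not_isSoluble_padic_of_dvd_left (c := (p : ℤ)) (c' := -(s ^ 2 * q ^ 2 * l ^ 2)) (dvd_refl _)
        (by simpa using hnd 1 (fun h => hP.one_lt.ne' (by exact_mod_cast Int.eq_one_of_dvd_one (by positivity) h))) hmsq
    · exact Or.inr rfl
    · -- d = qp : dies at 2
      exact absurd ((key (-(s ^ 2 * q * l ^ 2)) (by ring)).2 2) k2
    · -- d = -qp : dies at p
      refine absurd ((key (s ^ 2 * q * l ^ 2) (by ring)).2 p) ?_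
      exact not_isSoluble_padic_of_dvd_left (c := -((q : ℤ) * p)) (c' := s ^ 2 * q * l ^ 2) ⟨-q, by ring⟩
        (by rw [show (-((q : ℤ) * p)) = p * (-q) by ring]
            exact hnd _ (by rw [dvd_neg]; exact fun h => hqp (((Nat.prime_dvd_prime_iff_eq hP hQ).mp (by exact_mod_cast h))).symm))
        hqsq
  · rintro (rfl | rfl)
    · exact one_mem_twoIsogenySelmerGroup 0 hb
    · refine mem_twoIsogenySelmerGroup_of_isSquare hb ?_ ⟨s ^ 2 * q ^ 2 * l ^ 2, by ring⟩ ⟨s * q * l, ?_⟩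
      · exact Int.squarefree_natAbs.mp (by rw [Int.natAbs_neg, Int.natAbs_natCast]; exact hP.prime.squarefree)
      · rw [show (-(s ^ 2 * q ^ 2 * l ^ 2 * p : ℤ)) = -(p : ℤ) * (s ^ 2 * q ^ 2 * l ^ 2) by ring,
          Int.mul_ediv_cancel_left _ (neg_ne_zero.mpr hp0)]
        ring

end SSide

end Summit.BirchSwinnertonDyer.BirchSwinnertonDyer.Theorems.BiquadraticEisensteinDescentHeegnerTwistCouplingInSupplyQuarticMinusTripleDescent

end
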